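import Literature.AlgebraicGeometry.Resolution.ValuationDefect
import Literature.AlgebraicGeometry.Resolution.FundamentalInequality
import Mathlib.LinearAlgebra.FiniteDimensional.Lemmas
import Mathlib.Data.Finset.Lattice.Prod

/-!
# Best approximations exist in defectless unibranched extensions

Helper file for the crux `Valuative.LuAlphaPTorsor` (item `stmt-ResolutionOfSingularities-0641`),
line `pfaff-line-log-final-forms`, stub `stub_dimTwoImmediate` (the IMMEDIATE branch of the
value / residue / immediate trichotomy for `t` over `K₀` is the defect case):

* `exists_forall_valuation_sub_le_of_isDefectlessIn` (registered helper; section-variable form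
  `…'`) — if a finite extension `L/K` with valuation ring `O'` of `L` is UNIBRANCHED (`O'` is
  the only valuation ring of `L` over `O' ∩ K`) and DEFECTLESS (`e·f = [L : K]`,
  `IsDefectlessIn`), every `t ∈ L` has a best approximation in `K` (some `c ∈ K` minimises
  `ν(t − c)`). Proof: coset representatives times residue-basis lifts form a
  valuation-independent basis (linear independence is the tree's
  `linearIndependent_mul_of_valuation_of_residue`; valuation independence is re-proved by the
  same row-sum argument), and on such a basis `ν(t − c)` is a maximum of finitely many terms
  `ν(gᵢ − c λᵢ)·ν(aᵢ)`, minimised at one of the points `gᵢ/λᵢ` (ultrametric minimisation).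
  Contrapositive for the crux: in the immediate branch `K₀(t)/K₀` has defect, so by Kuhlmann's
  generalized stability theorem (PROVED in the tree) the valuation is not an Abhyankar place.
-/

set_option linter.dupNamespace false

namespace Summit.ResolutionOfSingularities.ResolutionOfSingularities.Theorems.PfaffLine

open IsLocalRing Literature.AlgebraicGeometry.Resolution

section Ultrametric

variable {K L : Type} [Field K] [Field L] [Algebra K L] (O' : ValuationSubring L)

/-- **Ultrametric minimisation.** For finitely many "affine terms"
`c ↦ ν(gᵢ − c·λᵢ)·rᵢ` (`gᵢ, λᵢ ∈ K`, weights `rᵢ`), at least one with `λᵢ ≠ 0`, the maximum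
over `i` attains its minimum over `c ∈ K` — at one of the points `gᵢ/λᵢ`. [folklore] -/
theorem exists_forall_sup_valuation_affine_le {ι : Type} [Fintype ι]
    (g lam : ι → K) (r : ι → ValuationSubring.ValueGroup O') (h : ∃ i, lam i ≠ 0) :
    ∃ c₀ : K, ∀ c : K,
      (Finset.univ.sup fun i => O'.valuation (algebraMap K L (g i - c₀ * lam i)) * r i) ≤
        Finset.univ.sup fun i => O'.valuation (algebraMap K L (g i - c * lam i)) * r i := by
  classical
  -- the candidate points `pᵢ = gᵢ/λᵢ`, `λᵢ ≠ 0`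
  set P : Finset ι := Finset.univ.filter fun i => lam i ≠ 0 with hP
  have hPne : P.Nonempty := by
    obtain ⟨i, hi⟩ := h
    exact ⟨i, by simp [hP, hi]⟩
  set Φ : K → ValuationSubring.ValueGroup O' :=
    fun c => Finset.univ.sup fun i => O'.valuation (algebraMap K L (g i - c * lam i)) * r i
    with hΦ
  -- a candidate minimising `Φ` among the candidates
  obtain ⟨m, -, hmin⟩ := P.exists_min_image (fun i => Φ (g i / lam i)) hPne
  refine ⟨g m / lam m, fun c => ?_⟩
  change Φ (g m / lam m) ≤ Φ c
  -- the candidate nearest to `c`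
  obtain ⟨m₀, hm₀P, hnear⟩ :=
    P.exists_min_image (fun i => O'.valuation (algebraMap K L (g i / lam i - c))) hPne
  refine (hmin m₀ hm₀P).trans ?_
  -- `Φ (p_{m₀}) ≤ Φ c`, term by term
  refine Finset.sup_le fun i _ => ?_
  refine le_trans ?_ (Finset.le_sup
    (f := fun i => O'.valuation (algebraMap K L (g i - c * lam i)) * r i) (Finset.mem_univ i))
  by_cases hli : lam i = 0
  · simp [hli]
  · have hiP : i ∈ P := by simp [hP, hli]
    have hfac : ∀ c' : K, g i - c' * lam i = lam i * (g i / lam i - c') := fun c' => by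
      field_simp
    rw [hfac, hfac c]
    simp only [map_mul]
    -- `ν(pᵢ − p_{m₀}) ≤ max (ν(pᵢ − c), ν(p_{m₀} − c)) = ν(pᵢ − c)`
    have h1 : g i / lam i - g m₀ / lam m₀ = (g i / lam i - c) - (g m₀ / lam m₀ - c) := by ring
    have h2 : O'.valuation (algebraMap K L (g i / lam i - g m₀ / lam m₀)) ≤
        O'.valuation (algebraMap K L (g i / lam i - c)) := by
      rw [h1, map_sub]
      exact (Valuation.map_sub _ _ _).trans (max_le le_rfl (hnear i hiP))
    exact mul_le_mul' (mul_le_mul' le_rfl h2) le_rfl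

end Ultrametric

section Independence

variable {K L : Type} [Field K] [Field L] [Algebra K L] (O' : ValuationSubring L)

/-- A `K`-combination of units of `L°` with residues linearly independent over the residue
field of `K` has the value of its largest coefficient. [folklore] -/
theorem valuation_sum_mul_eq_of_residue_linearIndependent {f : ℕ} (b : Fin f → O')
    (hb : LinearIndependent (residueSubfield K O') fun j => residue O' (b j))
    (g : Fin f → K) (j₀ : Fin f) (hj₀ : g j₀ ≠ 0)
    (hmax : ∀ j, O'.valuation (algebraMap K L (g j)) ≤ O'.valuation (algebraMap K L (g j₀))) :
    O'.valuation (∑ j, algebraMap K L (g j) * (b j : L)) =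
      O'.valuation (algebraMap K L (g j₀)) := by
  classical
  have hc0 : algebraMap K L (g j₀) ≠ 0 := by simpa using hj₀
  have hvc0 : O'.valuation (algebraMap K L (g j₀)) ≠ 0 := (Valuation.ne_zero_iff _).mpr hc0
  -- normalised coefficients `gⱼ/g_{j₀}` lie in `L°`
  have hgO : ∀ j, algebraMap K L (g j / g j₀) ∈ O' := fun j => by
    refine (O'.valuation_le_one_iff _).mp ?_
    rw [map_div₀, map_div₀]
    exact (div_le_one₀ (zero_lt_iff.mpr hvc0)).mpr (hmax j)
  -- the normalised sum `T`
  let T : O' := ∑ j, (⟨algebraMap K L (g j / g j₀), hgO j⟩ : O') * b j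
  have hT : (T : L) * algebraMap K L (g j₀) = ∑ j, algebraMap K L (g j) * (b j : L) := by
    change ((∑ j, (⟨algebraMap K L (g j / g j₀), hgO j⟩ : O') * b j : O') : L) * _ = _
    rw [AddSubmonoidClass.coe_finsetSum, Finset.sum_mul]
    refine Finset.sum_congr rfl fun j _ => ?_
    change algebraMap K L (g j / g j₀) * (b j : L) * algebraMap K L (g j₀) = _
    rw [map_div₀, div_mul_eq_mul_div, div_mul_cancel₀ _ hc0]
  -- its residue is a non-trivial combination of the independent residues, hence non-zero
  have hres : residue O' T ≠ 0 := by
    intro h0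
    have hcoef : ∀ j, residue O' ⟨algebraMap K L (g j / g j₀), hgO j⟩ ∈ residueSubfield K O' :=
      fun j => residue_mem_residueSubfield K O' (g j / g j₀) (hgO j)
    have hsum : ∑ j, (⟨_, hcoef j⟩ : residueSubfield K O') • residue O' (b j) = 0 := by
      have h1 : residue O' T = ∑ j, residue O' ⟨_, hgO j⟩ * residue O' (b j) := by
        simp only [T, map_sum, map_mul]
      rw [← h0, h1]
      rfl
    have h1 := (Fintype.linearIndependent_iff.mp hb) (fun j => ⟨_, hcoef j⟩) hsum j₀
    rw [Subtype.ext_iff] at h1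
    change residue O' ⟨algebraMap K L (g j₀ / g j₀), hgO j₀⟩ = 0 at h1
    rw [residue_eq_zero_iff] at h1
    have hone : (⟨algebraMap K L (g j₀ / g j₀), hgO j₀⟩ : O') = 1 :=
      Subtype.ext (by change algebraMap K L (g j₀ / g j₀) = 1; rw [div_self hj₀, map_one])
    rw [hone] at h1
    exact (IsLocalRing.mem_maximalIdeal _).mp h1 isUnit_one
  have hTunit : IsUnit T := by
    by_contra hnu
    exact hres ((residue_eq_zero_iff T).mpr ((IsLocalRing.mem_maximalIdeal _).mpr hnu))
  have hvT : O'.valuation (T : L) = 1 := (O'.valuation_eq_one_iff T).mp hTunit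
  rw [← hT, Valuation.map_mul, hvT, one_mul]

/-- The value of a `K`-combination of units `bⱼ ∈ L°` with linearly independent residues is the
maximum of the values of the coefficients (valuation independence of a residue basis).
[folklore] -/
theorem valuation_sum_mul_eq_sup_of_residue_linearIndependent {f : ℕ} (b : Fin f → O')
    (hb : LinearIndependent (residueSubfield K O') fun j => residue O' (b j)) (g : Fin f → K) :
    O'.valuation (∑ j, algebraMap K L (g j) * (b j : L)) =
      Finset.univ.sup fun j => O'.valuation (algebraMap K L (g j)) := by
  classical
  by_cases hzero : ∀ j, g j = 0
  · have h1 : ∑ j, algebraMap K L (g j) * (b j : L) = 0 :=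
      Finset.sum_eq_zero fun j _ => by simp [hzero j]
    rw [h1, Valuation.map_zero]
    symm
    refine le_antisymm (Finset.sup_le fun j _ => ?_) zero_le
    simp [hzero j]
  push Not at hzero
  obtain ⟨j₁, hj₁⟩ := hzero
  obtain ⟨j₀, -, hmax⟩ :=
    Finset.univ.exists_max_image (fun j => O'.valuation (algebraMap K L (g j))) ⟨j₁, Finset.mem_univ _⟩
  have hj₀ : g j₀ ≠ 0 := by
    intro h0
    have h1 := hmax j₁ (Finset.mem_univ _)
    rw [h0, map_zero, Valuation.map_zero, le_zero_iff, Valuation.zero_iff] at h1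
    exact hj₁ (by simpa using h1)
  rw [valuation_sum_mul_eq_of_residue_linearIndependent O' b hb g j₀ hj₀ fun j => hmax j (Finset.mem_univ _)]
  apply le_antisymm
  · exact Finset.le_sup (f := fun j => O'.valuation (algebraMap K L (g j))) (Finset.mem_univ j₀)
  · exact Finset.sup_le fun j _ => hmax j (Finset.mem_univ _)

/-- A finite sum whose non-zero terms have pairwise distinct values has the value of its largest
term. [folklore] -/
theorem valuation_sum_eq_sup_of_pairwise_ne {ι : Type} [Fintype ι] (x : ι → L)
    (hne : ∀ i i', i ≠ i' → x i ≠ 0 → x i' ≠ 0 → O'.valuation (x i) ≠ O'.valuation (x i')) :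
    O'.valuation (∑ i, x i) = Finset.univ.sup fun i => O'.valuation (x i) := by
  classical
  by_cases hzero : ∀ i, x i = 0
  · have h1 : ∑ i, x i = 0 := Finset.sum_eq_zero fun i _ => hzero i
    rw [h1, Valuation.map_zero]
    symm
    refine le_antisymm (Finset.sup_le fun i _ => ?_) zero_le
    simp [hzero i]
  push Not at hzero
  obtain ⟨i₁, hi₁⟩ := hzero
  obtain ⟨i₀, -, hmax⟩ :=
    Finset.univ.exists_max_image (fun i => O'.valuation (x i)) ⟨i₁, Finset.mem_univ _⟩
  have hi₀ : x i₀ ≠ 0 := by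
    intro h0
    have h1 := hmax i₁ (Finset.mem_univ _)
    rw [h0, Valuation.map_zero, le_zero_iff, Valuation.zero_iff] at h1
    exact hi₁ h1
  have hsum : O'.valuation (∑ i, x i) = O'.valuation (x i₀) := by
    refine Valuation.map_sum_eq_of_lt _ (Finset.mem_univ i₀) fun i hi => ?_
    rw [Finset.mem_sdiff, Finset.mem_singleton] at hi
    by_cases hxi : x i = 0
    · rw [hxi, Valuation.map_zero]
      exact zero_lt_iff.mpr ((Valuation.ne_zero_iff _).mpr hi₀)
    · exact lt_of_le_of_ne (hmax i (Finset.mem_univ _)) (hne i i₀ hi.2 hxi hi₀)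
  rw [hsum]
  apply le_antisymm
  · exact Finset.le_sup (f := fun i => O'.valuation (x i)) (Finset.mem_univ i₀)
  · exact Finset.sup_le fun i _ => hmax i (Finset.mem_univ _)

/-- **Valuation independence.** For non-zero `aᵢ ∈ L` with values in distinct cosets modulo the
values of `K^×` and units `bⱼ ∈ L°` with residues linearly independent over the residue field of
`K`, the value of a `K`-linear combination `∑ gᵢⱼ aᵢ bⱼ` is the maximum of the values of its
terms `ν(gᵢⱼ)·ν(aᵢ)`. [folklore] -/
theorem valuation_sum_mul_eq_sup {e f : ℕ} (a : Fin e → L) (ha0 : ∀ i, a i ≠ 0)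
    (hdist : ∀ i i', i ≠ i' →
      (Units.mk0 (O'.valuation (a i)) ((Valuation.ne_zero_iff _).mpr (ha0 i)))⁻¹ *
        Units.mk0 (O'.valuation (a i')) ((Valuation.ne_zero_iff _).mpr (ha0 i')) ∉
          valueSubgroup K O')
    (b : Fin f → O') (hb : LinearIndependent (residueSubfield K O') fun j => residue O' (b j))
    (g : Fin e × Fin f → K) :
    O'.valuation (∑ q, algebraMap K L (g q) * (a q.1 * (b q.2 : L))) =
      Finset.univ.sup fun q => O'.valuation (algebraMap K L (g q)) * O'.valuation (a q.1) := by
  classical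
  -- row sums `Sᵢ = ∑ⱼ gᵢⱼ bⱼ`
  let S : Fin e → L := fun i => ∑ j, algebraMap K L (g (i, j)) * (b j : L)
  have hsumS : ∑ q, algebraMap K L (g q) * (a q.1 * (b q.2 : L)) = ∑ i, a i * S i := by
    rw [Fintype.sum_prod_type]
    refine Finset.sum_congr rfl fun i _ => ?_
    rw [Finset.mul_sum]
    exact Finset.sum_congr rfl fun j _ => by ring
  have hrow : ∀ i, O'.valuation (S i) =
      Finset.univ.sup fun j => O'.valuation (algebraMap K L (g (i, j))) := fun i =>
    valuation_sum_mul_eq_sup_of_residue_linearIndependent O' b hb fun j => g (i, j)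
  -- the value of a non-zero row sum is the value of an element of `K^×`
  have hrowK : ∀ i, S i ≠ 0 → ∃ c : K, c ≠ 0 ∧ O'.valuation (S i) = O'.valuation (algebraMap K L c) := by
    intro i hSi
    have hex : ∃ j, g (i, j) ≠ 0 := by
      by_contra hcon
      push Not at hcon
      exact hSi (Finset.sum_eq_zero fun j _ => by simp [hcon j])
    obtain ⟨j₁, hj₁⟩ := hex
    obtain ⟨j₀, -, hmax⟩ := Finset.univ.exists_max_image
      (fun j => O'.valuation (algebraMap K L (g (i, j)))) ⟨j₁, Finset.mem_univ _⟩
    have hj₀ : g (i, j₀) ≠ 0 := by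
      intro h0
      have h1 := hmax j₁ (Finset.mem_univ _)
      rw [h0, map_zero, Valuation.map_zero, le_zero_iff, Valuation.zero_iff] at h1
      exact hj₁ (by simpa using h1)
    exact ⟨g (i, j₀), hj₀, valuation_sum_mul_eq_of_residue_linearIndependent O' b hb
      (fun j => g (i, j)) j₀ hj₀ fun j => hmax j (Finset.mem_univ _)⟩
  -- the non-zero terms `aᵢ Sᵢ` have pairwise distinct values (distinct cosets)
  have hne : ∀ i i', i ≠ i' → a i * S i ≠ 0 → a i' * S i' ≠ 0 →
      O'.valuation (a i * S i) ≠ O'.valuation (a i' * S i') := by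
    intro i i' hii' h1 h2 heq
    have hS1 : S i ≠ 0 := fun h => h1 (by rw [h, mul_zero])
    have hS2 : S i' ≠ 0 := fun h => h2 (by rw [h, mul_zero])
    obtain ⟨c, hc0, hc⟩ := hrowK i hS1
    obtain ⟨c', hc0', hc'⟩ := hrowK i' hS2
    apply hdist i i' hii'
    rw [mem_valueSubgroup_iff]
    refine ⟨c / c', div_ne_zero hc0 hc0', ?_⟩
    rw [Valuation.map_mul, Valuation.map_mul, hc, hc'] at heq
    have hvc' : O'.valuation (algebraMap K L c') ≠ 0 := by simpa using hc0'
    have hva : O'.valuation (a i) ≠ 0 := (Valuation.ne_zero_iff _).mpr (ha0 i)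
    rw [Units.val_mul, Units.val_inv_eq_inv_val, Units.val_mk0, Units.val_mk0, map_div₀,
      map_div₀, eq_div_iff hvc', mul_assoc, inv_mul_eq_iff_eq_mul₀ hva]
    exact heq.symm
  rw [hsumS, valuation_sum_eq_sup_of_pairwise_ne O' (fun i => a i * S i) hne]
  -- `sup_i (ν(aᵢ) · sup_j ν(gᵢⱼ)) = sup_{ij} ν(gᵢⱼ) ν(aᵢ)`
  rw [← Finset.univ_product_univ, Finset.sup_product_left]
  refine Finset.sup_congr rfl fun i _ => ?_
  rw [Valuation.map_mul, hrow i, mul_comm]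
  rw [Finset.apply_sup_eq_sup_comp_of_linearOrder (fun x => x * O'.valuation (a i))
    (fun x y hxy => mul_le_mul' hxy le_rfl) (by simp [bot_eq_zero])]
  rfl

end Independence

section Main

variable {K L : Type} [Field K] [Field L] [Algebra K L] (O' : ValuationSubring L)

/-- **Best approximations in a defectless unibranched finite extension.** Let `L/K` be finite,
`O' = L°` a valuation ring of `L` which is the ONLY valuation ring of `L` over `K° = O' ∩ K`,
and suppose `(K, K°)` is defectless in `L` (`e·f = [L : K]`). Then every `t ∈ L` has a best
approximation from `K`: for some `c₀ ∈ K`, `ν(t − c₀) ≤ ν(t − c)` for all `c ∈ K`. Hence an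
element whose approximations from `K` can always be improved witnesses DEFECT.
[folklore; e.g. F.-V. Kuhlmann's "defectless ⇒ valuation bases"] -/
theorem exists_forall_valuation_sub_le_of_isDefectlessIn' [FiniteDimensional K L]
    (huniq : ∀ O'' : ValuationSubring L,
      O''.comap (algebraMap K L) = O'.comap (algebraMap K L) → O'' = O')
    (hdef : IsDefectlessIn K (O'.comap (algebraMap K L)) L) (t : L) :
    ∃ c₀ : K, ∀ c : K, O'.valuation (t - algebraMap K L c₀) ≤ O'.valuation (t - algebraMap K L c) := by
  classical
  -- `e · f = n`
  obtain ⟨s, hs, hsum⟩ := hdef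
  have hsO : s = {O'} := by
    refine Finset.eq_singleton_iff_unique_mem.mpr ⟨(hs O').mpr rfl, fun O'' hO'' => huniq O'' ((hs O'').mp hO'')⟩
  rw [hsO, Finset.sum_singleton] at hsum
  set e := ramificationIndex K O' with he
  set f := inertiaDegree K O' with hf
  have hn : 0 < Module.finrank K L := Module.finrank_pos
  have he0 : e ≠ 0 := fun h => by rw [h, zero_mul] at hsum; omega
  have hf0 : f ≠ 0 := fun h => by rw [h, mul_zero] at hsum; omega
  -- coset representatives of `|L^×| / |K^×|`
  set H : Subgroup (ValuationSubring.ValueGroup O')ˣ := valueSubgroup K O' with hH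
  letI : Fintype ((ValuationSubring.ValueGroup O')ˣ ⧸ H) := Subgroup.fintypeOfIndexNeZero he0
  have hcard : Fintype.card ((ValuationSubring.ValueGroup O')ˣ ⧸ H) = e := by
    rw [he, ramificationIndex, ← hH, Subgroup.index_eq_card, Nat.card_eq_fintype_card]
  let enum : Fin e ≃ ((ValuationSubring.ValueGroup O')ˣ ⧸ H) :=
    (Fintype.equivFinOfCardEq hcard).symm
  have ha : ∀ i : Fin e, ∃ z : L, z ≠ 0 ∧
      O'.valuation z = (((enum i).out : (ValuationSubring.ValueGroup O')ˣ) : ValuationSubring.ValueGroup O') := by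
    intro i
    obtain ⟨z, hz⟩ := O'.valuation_surjective
      (((enum i).out : (ValuationSubring.ValueGroup O')ˣ) : ValuationSubring.ValueGroup O')
    refine ⟨z, fun h0 => ?_, hz⟩
    rw [h0, Valuation.map_zero] at hz
    exact (Units.ne_zero _) hz.symm
  choose a ha0 hav using ha
  have hmk : ∀ i, Units.mk0 (O'.valuation (a i)) ((Valuation.ne_zero_iff _).mpr (ha0 i)) = (enum i).out :=
    fun i => Units.ext (hav i)
  have hdist : ∀ i i', i ≠ i' →
      (Units.mk0 (O'.valuation (a i)) ((Valuation.ne_zero_iff _).mpr (ha0 i)))⁻¹ *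
        Units.mk0 (O'.valuation (a i')) ((Valuation.ne_zero_iff _).mpr (ha0 i')) ∉ H := by
    intro i i' hii' hmem
    rw [hmk, hmk, ← QuotientGroup.eq, QuotientGroup.out_eq', QuotientGroup.out_eq'] at hmem
    exact hii' (enum.injective hmem)
  -- a residue basis, lifted to `L°`
  set Lres : Subfield (ResidueField O') := residueSubfield K O' with hLres
  haveI : Module.Finite Lres (ResidueField O') := Module.finite_of_finrank_pos (Nat.pos_of_ne_zero hf0)
  let B : Module.Basis (Fin f) Lres (ResidueField O') := Module.finBasisOfFinrankEq Lres (ResidueField O') rfl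
  have hb' : ∀ j : Fin f, ∃ y : O', residue O' y = B j := fun j => Ideal.Quotient.mk_surjective (B j)
  choose b hb using hb'
  have hbli : LinearIndependent Lres fun j => residue O' (b j) := by
    have : (fun j => residue O' (b j)) = B := funext hb
    rw [this]
    exact B.linearIndependent
  -- the products form a `K'`-basis of `L`, `K' = im (K → L)`
  set F : Subfield L := (algebraMap K L).fieldRange with hF
  have hHF : ∀ c : L, c ∈ F → (hc : c ≠ 0) →
      Units.mk0 (O'.valuation c) ((Valuation.ne_zero_iff _).mpr hc) ∈ H := by
    rintro _ ⟨x, rfl⟩ hc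
    rw [hH, mem_valueSubgroup_iff]
    exact ⟨x, fun h => hc (by simp [h]), rfl⟩
  have hLF : ∀ c : L, c ∈ F → (hc : c ∈ O') → residue O' ⟨c, hc⟩ ∈ Lres := by
    rintro _ ⟨x, rfl⟩ hc
    exact residue_mem_residueSubfield K O' x hc
  have hli : LinearIndependent F fun q : Fin e × Fin f => a q.1 * (b q.2 : L) :=
    linearIndependent_mul_of_valuation_of_residue O' F H hHF Lres hLF a ha0 hdist b hbli
  haveI : FiniteDimensional F L := by
    rw [hF]
    exact Module.finite_of_finrank_pos (by rw [finrank_fieldRange_eq]; exact hn)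
  have hcardq : Fintype.card (Fin e × Fin f) = Module.finrank F L := by
    rw [Fintype.card_prod, Fintype.card_fin, Fintype.card_fin, hF, finrank_fieldRange_eq, ← hsum]
  haveI : Nonempty (Fin e × Fin f) := ⟨(⟨0, Nat.pos_of_ne_zero he0⟩, ⟨0, Nat.pos_of_ne_zero hf0⟩)⟩
  let P : Module.Basis (Fin e × Fin f) F L := basisOfLinearIndependentOfCardEqFinrank hli hcardq
  have hP : ∀ q, P q = a q.1 * (b q.2 : L) := fun q => by
    simp [P]
  -- coordinates of `t` and of `1`, pulled back to `K`
  have hrepr : ∀ u : L, ∃ g : Fin e × Fin f → K,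
      u = ∑ q, algebraMap K L (g q) * (a q.1 * (b q.2 : L)) := by
    intro u
    have hq : ∀ q, ∃ x : K, algebraMap K L x = ((P.repr u q : F) : L) := fun q => (P.repr u q).2
    choose g hg using hq
    refine ⟨g, ?_⟩
    conv_lhs => rw [← P.sum_repr u]
    refine Finset.sum_congr rfl fun q _ => ?_
    rw [Subfield.smul_def, smul_eq_mul, hg, hP]
  obtain ⟨g, hg⟩ := hrepr t
  obtain ⟨lam, hlam⟩ := hrepr 1
  have hlam0 : ∃ q, lam q ≠ 0 := by
    by_contra hcon
    push Not at hcon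
    have : (1 : L) = 0 := by
      rw [hlam]
      exact Finset.sum_eq_zero fun q _ => by simp [hcon q]
    exact one_ne_zero this
  -- `t - c = ∑ (g - c λ) · aᵢ bⱼ` and its value
  have hexp : ∀ c : K, t - algebraMap K L c =
      ∑ q, algebraMap K L (g q - c * lam q) * (a q.1 * (b q.2 : L)) := by
    intro c
    have h1 : algebraMap K L c = ∑ q, algebraMap K L (c * lam q) * (a q.1 * (b q.2 : L)) := by
      conv_lhs => rw [← mul_one (algebraMap K L c), hlam, Finset.mul_sum]
      refine Finset.sum_congr rfl fun q _ => ?_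
      rw [map_mul]
      ring
    conv_lhs => rw [hg, h1]
    rw [← Finset.sum_sub_distrib]
    refine Finset.sum_congr rfl fun q _ => ?_
    rw [map_sub]
    ring
  have hval : ∀ c : K, O'.valuation (t - algebraMap K L c) =
      Finset.univ.sup fun q => O'.valuation (algebraMap K L (g q - c * lam q)) * O'.valuation (a q.1) := by
    intro c
    rw [hexp c]
    exact valuation_sum_mul_eq_sup O' a ha0 hdist b hbli fun q => g q - c * lam q
  obtain ⟨c₀, hc₀⟩ := exists_forall_sup_valuation_affine_le O' g lam (fun q => O'.valuation (a q.1)) hlam0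
  refine ⟨c₀, fun c => ?_⟩
  rw [hval, hval]
  exact hc₀ c

/-- **Best approximations in a defectless unibranched finite extension** (registered helper form
of `exists_forall_valuation_sub_le_of_isDefectlessIn'`, binders explicit). [folklore] -/
theorem exists_forall_valuation_sub_le_of_isDefectlessIn :
    ∀ {K L : Type} [Field K] [Field L] [Algebra K L] (O' : ValuationSubring L) [FiniteDimensional K L], (∀ O'' : ValuationSubring L, O''.comap (algebraMap K L) = O'.comap (algebraMap K L) → O'' = O') → Literature.AlgebraicGeometry.Resolution.IsDefectlessIn K (O'.comap (algebraMap K L)) L → ∀ (t : L), ∃ c₀ : K, ∀ c : K, O'.valuation (t - algebraMap K L c₀) ≤ O'.valuation (t - algebraMap K L c) := by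
  intro K L _ _ _ O' _ huniq hdef t
  exact exists_forall_valuation_sub_le_of_isDefectlessIn' O' huniq hdef t

end Main

end Summit.ResolutionOfSingularities.ResolutionOfSingularities.Theorems.PfaffLine
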